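import Summits.HodgeConjecture.HodgeConjecture.Theorems.Ring2AbelianAllWeilHyperbolicDescent
import HarnessLib

/-!
# Ring 2 · AbelianAll (ab-weil-1, gen 6), part A — the discriminant class `det H` along equivariant
  isogenies and under the change of generator `(mψ, m²d) ↔ (ψ, d)`, on the carriers

research route, not a corollary; conditional on HC_CM plus one named minimal statement.
Cell line: research route conditional on HC_CM; not a corollary; Q11.4-sentence-2 already refuted in dim ≥ 3.
`HC_CM` (`Theses.RankFourFaces.CMAbelianHodge`) does not occur in this file, and no case of the Hodge
conjecture is claimed or used: this part is pure (bi)linear algebra on the cohomology carriers and the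
arithmetic of the Weil fields `K_d = ℚ[X]/(X² + d)`; part B (`Ring2AbelianAllWeilComponentsDescent`)
applies it to the discriminant-indexed class targets `Ring2.Hypotheses.WeilClassesComponent n d δ`.

Gen 4 re-indexed the UNPOLARIZED Weil statements by squarefree `d`, gen 5 the HYPERBOLIC / NON-SPLIT
rungs (`IsHyperbolicWeilType` along the descent isogeny), and gen 5 left OUT OF SCOPE van Geemen's third
discrete invariant `det H ∈ ℚˣ/Nm(K_dˣ)` itself (`VanGeemen1994.HasWeilDiscriminantNondeg`). Here:

* §1 `weilFieldHom`, `weilFieldEquiv` — the `ℚ`-algebra isomorphism `K_{m²d} ≃ K_d`, `√-(m²d) ↦ m·√-d`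
  (`m ≥ 1`), its action on Gram matrices `a + b√-(m²d) ↦ a + mb√-d`
  (`weilFieldHom_mapMatrix_weilGramMatrix`); `normUnitsSubgroup_weilField_sq_mul` — the norm groups
  `Nm(K_{m²d}ˣ) = Nm(K_dˣ) ≤ ℚˣ` COINCIDE, so the norm residue groups in which `det H` lives are the same
  quotient of `ℚˣ`: `weilNormResidueGroupCongr hm d : ℚˣ/Nm(K_{m²d}ˣ) ≃* ℚˣ/Nm(K_dˣ)`, the identity on
  representatives, taking the split class `(-1)ⁿ` to the split class; even powers `u^{2n} = Nm(uⁿ)` are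
  norms (`mk_pow_two_mul_pow_mul`, `[K_d : ℚ] = 2`);
* §2 van Geemen's Lemma 5.2 (3) "`det H` … is an isogeny invariant" ON THE CARRIERS, for every class:
  `hasWeilDiscriminantNondeg_comap_of_comm` (a non-degenerate witness pulls back along a `K`-equivariant
  homomorphism injective on `H¹` and `H^{2+2(2n-1)}`: `xᵢ ↦ g^*xᵢ`, `ω ↦ g^*ω`, the rational matrices
  `a`, `b`, the Gram matrix `Ψ` and `det Ψ = q` UNCHANGED), `hasWeilDiscriminantNondeg_iff_of_isIsogeny`
  (invariance under `K`-equivariant isogenies, via the equivariant quasi-inverse), and the change of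
  generator on ONE variety `hasWeilDiscriminantNondeg_natCast_zsmul_iff`: `(B, mψ, m²d, h)` has class `δ`
  iff `(B, ψ, d, h)` has class `congr δ` — in one `K`-basis the Gram matrices are `a + b√-(m²d) ↦
  m·(m⁻¹a + b√-d)`, so `det` changes by the NORM `m^{2n}` and the class not at all; with the symmetrised
  classes, `hasWeilDiscriminantNondeg_symmetrised_natCast_zsmul_iff`.

## References
* B. van Geemen, *An introduction to the Hodge conjecture for abelian varieties*, LNM 1594 (1994),
  4.14, Lemma 5.2 (2)–(3), 5.4 and (5.4.1). [vanGeemen1994HodgeAV]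
* D. Mumford, *Abelian Varieties* (1970), §19 Thm. 3 and Remark p. 169. [MumfordAV1970]
* A. Hatcher, *Algebraic Topology* (2002), Prop. 3.10. [HatcherAT2002]
-/

noncomputable section

set_option linter.dupNamespace false

open CategoryTheory Polynomial
open Literature.AlgebraicGeometry Literature.AlgebraicGeometry.Motives
open Literature.AlgebraicGeometry.HodgeTheory
open Literature.AlgebraicGeometry.VanGeemen1994
open Literature.AlgebraicTopology.SingularHomology
open Summit.HodgeConjecture.HodgeConjecture.Cruxes.HodgeAbelianVarieties.EStepSecantInduction
open Summit.HodgeConjecture.HodgeConjecture.WeilTypeLadder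
open Summit.HodgeConjecture.HodgeConjecture.Ring2.Hypotheses
open Summit.HodgeConjecture.HodgeConjecture.Ring2.Habitat

namespace Summit.HodgeConjecture.HodgeConjecture.Ring2.AbelianAll

/-! ### §1 The Weil fields `K_{m²d} ≃ K_d` and their norm residue groups -/

/-- `X² + D` vanishes at `c·√-d'` in `K_{d'}` when `c² d' = D`. [folklore] -/
theorem eval₂_X_sq_add_C_rescale {D d' : ℕ} {c : ℚ} (h : c ^ 2 * d' = D) :
    eval₂ (algebraMap ℚ (weilField d')) (algebraMap ℚ (weilField d') c * weilSqrt d')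
      (X ^ 2 + C (D : ℚ) : ℚ[X]) = 0 := by
  rw [eval₂_add, eval₂_X_pow, eval₂_C, mul_pow, sq (weilSqrt d'), weilSqrt_sq, ← map_pow, ← h,
    map_mul, mul_neg]
  exact neg_add_cancel _

/-- **The rescaling homomorphism `K_D → K_{d'}`, `√-D ↦ c·√-d'`** of `ℚ`-algebras (`c² d' = D`): for
`(D, d', c) = (m²d, d, m)` the identification `ℚ(√-m²d) = ℚ(√-d)`, for `(d, m²d, m⁻¹)` its inverse. [folklore] -/
def weilFieldHom (D d' : ℕ) (c : ℚ) (h : c ^ 2 * d' = D) : weilField D →ₐ[ℚ] weilField d' :=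
  AdjoinRoot.liftAlgHom (X ^ 2 + C (D : ℚ) : ℚ[X]) (Algebra.ofId ℚ (weilField d'))
    (algebraMap ℚ (weilField d') c * weilSqrt d') (by
      rw [show ((Algebra.ofId ℚ (weilField d') : ℚ →ₐ[ℚ] weilField d') : ℚ →+* weilField d') =
          algebraMap ℚ (weilField d') from rfl]
      exact eval₂_X_sq_add_C_rescale h)

/-- `weilFieldHom` on the generator: `√-D ↦ c·√-d'`. [folklore] -/
theorem weilFieldHom_weilSqrt {D d' : ℕ} {c : ℚ} (h : c ^ 2 * d' = D) :
    weilFieldHom D d' c h (weilSqrt D) = algebraMap ℚ (weilField d') c * weilSqrt d' :=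
  AdjoinRoot.liftAlgHom_root _ _ _ _

/-- `weilFieldHom` on rationals. [folklore] -/
theorem weilFieldHom_algebraMap {D d' : ℕ} {c : ℚ} (h : c ^ 2 * d' = D) (r : ℚ) :
    weilFieldHom D d' c h (algebraMap ℚ (weilField D) r) = algebraMap ℚ (weilField d') r :=
  AlgHom.commutes _ r

/-- **The rescaling homomorphism on Gram matrices: `Ψ = a + b√-D ↦ a + (c b)√-d'`.**
[cite: vanGeemen1994HodgeAV, Lemma 5.2 (2)–(3)] -/
theorem weilFieldHom_mapMatrix_weilGramMatrix {D d' : ℕ} {c : ℚ} (h : c ^ 2 * d' = D) {k : ℕ}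
    (a b : Matrix (Fin k) (Fin k) ℚ) :
    (weilFieldHom D d' c h).mapMatrix (weilGramMatrix D a b) = weilGramMatrix d' a (c • b) := by
  ext i j
  rw [AlgHom.mapMatrix_apply, Matrix.map_apply, weilGramMatrix_apply, weilGramMatrix_apply, map_add,
    map_mul, weilFieldHom_algebraMap, weilFieldHom_algebraMap, weilFieldHom_weilSqrt, Matrix.smul_apply,
    smul_eq_mul, map_mul]
  ring

/-- `Ψ(c a, c b) = c · Ψ(a, b)`. [cite: vanGeemen1994HodgeAV, Lemma 5.2 (2)] -/
theorem weilGramMatrix_smul (d' : ℕ) {k : ℕ} (c : ℚ) (a b : Matrix (Fin k) (Fin k) ℚ) :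
    weilGramMatrix d' (c • a) (c • b) = algebraMap ℚ (weilField d') c • weilGramMatrix d' a b := by
  ext i j
  rw [Matrix.smul_apply, weilGramMatrix_apply, weilGramMatrix_apply, Matrix.smul_apply, Matrix.smul_apply,
    smul_eq_mul, smul_eq_mul, smul_eq_mul, map_mul, map_mul]
  ring

/-- `det Ψ(c a, c b) = cᵏ · det Ψ(a, b)` (`k × k` matrices). [cite: vanGeemen1994HodgeAV, Lemma 5.2 (3)] -/
theorem det_weilGramMatrix_smul (d' : ℕ) {k : ℕ} (c : ℚ) (a b : Matrix (Fin k) (Fin k) ℚ) :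
    (weilGramMatrix d' (c • a) (c • b)).det =
      algebraMap ℚ (weilField d') (c ^ k) * (weilGramMatrix d' a b).det := by
  rw [weilGramMatrix_smul, Matrix.det_smul, Fintype.card_fin, map_pow]

/-- **`det Ψ` under the rescaling `√-D ↦ c√-d'` with the first matrix divided by `c`**:
`det (c⁻¹a + b√-d') = c⁻ᵏ · ι(det (a + b√-D))` — the Gram determinants of `(mψ, √-(m²d))` and
`(ψ, √-d)` in one `K`-basis differ by `m^{2n}`, a norm. [cite: vanGeemen1994HodgeAV, Lemma 5.2 (3)] -/
theorem det_weilGramMatrix_inv_smul {D d' : ℕ} {c : ℚ} (hc : c ≠ 0) (h : c ^ 2 * d' = D) {k : ℕ}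
    (a b : Matrix (Fin k) (Fin k) ℚ) :
    (weilGramMatrix d' (c⁻¹ • a) b).det =
      algebraMap ℚ (weilField d') ((c ^ k)⁻¹) * weilFieldHom D d' c h (weilGramMatrix D a b).det := by
  rw [AlgHom.map_det, weilFieldHom_mapMatrix_weilGramMatrix,
    show weilGramMatrix d' a (c • b) = weilGramMatrix d' (c • (c⁻¹ • a)) (c • b) by
      rw [smul_smul, mul_inv_cancel₀ hc, one_smul],
    det_weilGramMatrix_smul, ← mul_assoc, ← map_mul, inv_mul_cancel₀ (pow_ne_zero k hc), map_one, one_mul]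

/-- `m² · d = m²d` in `ℚ` (the rescaling datum `√-(m²d) ↦ m√-d`). [folklore] -/
theorem weilField_rescale_eq (m d : ℕ) : ((m : ℚ)) ^ 2 * (d : ℕ) = ((m ^ 2 * d : ℕ) : ℕ) := by
  push_cast; ring

/-- `m⁻² · m²d = d` in `ℚ` (the rescaling datum `√-d ↦ m⁻¹√-(m²d)`, `m ≥ 1`). [folklore] -/
theorem weilField_rescale_inv_eq {m : ℕ} (hm : m ≠ 0) (d : ℕ) :
    ((m : ℚ)⁻¹) ^ 2 * ((m ^ 2 * d : ℕ) : ℕ) = (d : ℕ) := by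
  have : (m : ℚ) ≠ 0 := Nat.cast_ne_zero.mpr hm
  push_cast
  field_simp

/-- **`K_{m²d} ≃ K_d` as `ℚ`-algebras** (`m ≥ 1`): `ℚ(√-m²d) = ℚ(√-d)`. [folklore] -/
def weilFieldEquiv {m : ℕ} (hm : m ≠ 0) (d : ℕ) : weilField (m ^ 2 * d) ≃ₐ[ℚ] weilField d :=
  AlgEquiv.ofAlgHom (weilFieldHom (m ^ 2 * d) d (m : ℚ) (weilField_rescale_eq m d))
    (weilFieldHom d (m ^ 2 * d) ((m : ℚ)⁻¹) (weilField_rescale_inv_eq hm d))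
    (by
      apply AdjoinRoot.algHom_ext
      have hmQ : (m : ℚ) ≠ 0 := Nat.cast_ne_zero.mpr hm
      rw [AlgHom.comp_apply, AlgHom.id_apply]
      change weilFieldHom (m ^ 2 * d) d (m : ℚ) (weilField_rescale_eq m d)
          (weilFieldHom d (m ^ 2 * d) ((m : ℚ)⁻¹) (weilField_rescale_inv_eq hm d) (weilSqrt d)) = weilSqrt d
      rw [weilFieldHom_weilSqrt, map_mul, weilFieldHom_algebraMap, weilFieldHom_weilSqrt, ← mul_assoc,
        ← map_mul, inv_mul_cancel₀ hmQ, map_one, one_mul])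
    (by
      apply AdjoinRoot.algHom_ext
      have hmQ : (m : ℚ) ≠ 0 := Nat.cast_ne_zero.mpr hm
      rw [AlgHom.comp_apply, AlgHom.id_apply]
      change weilFieldHom d (m ^ 2 * d) ((m : ℚ)⁻¹) (weilField_rescale_inv_eq hm d)
          (weilFieldHom (m ^ 2 * d) d (m : ℚ) (weilField_rescale_eq m d) (weilSqrt (m ^ 2 * d))) =
        weilSqrt (m ^ 2 * d)
      rw [weilFieldHom_weilSqrt, map_mul, weilFieldHom_algebraMap, weilFieldHom_weilSqrt, ← mul_assoc,
        ← map_mul, mul_inv_cancel₀ hmQ, map_one, one_mul])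

/-- **The norm groups coincide: `Nm(K_{m²d}ˣ) = Nm(K_dˣ)` in `ℚˣ`** (the norm form is invariant under the
`ℚ`-algebra isomorphism `K_{m²d} ≃ K_d`). [cite: vanGeemen1994HodgeAV, 4.14] -/
theorem normUnitsSubgroup_weilField_sq_mul {m : ℕ} (hm : m ≠ 0) (d : ℕ) :
    normUnitsSubgroup ℚ (weilField (m ^ 2 * d)) = normUnitsSubgroup ℚ (weilField d) := by
  ext u
  rw [mem_normUnitsSubgroup_iff, mem_normUnitsSubgroup_iff]
  constructor
  · rintro ⟨k, hk⟩
    refine ⟨Units.map (weilFieldEquiv hm d : weilField (m ^ 2 * d) →* weilField d) k, ?_⟩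
    rw [Units.coe_map, MonoidHom.coe_coe, Algebra.norm_eq_of_algEquiv, hk]
  · rintro ⟨k, hk⟩
    refine ⟨Units.map ((weilFieldEquiv hm d).symm : weilField d →* weilField (m ^ 2 * d)) k, ?_⟩
    rw [Units.coe_map, MonoidHom.coe_coe, Algebra.norm_eq_of_algEquiv, hk]

/-- **The norm residue groups `ℚˣ/Nm(K_{m²d}ˣ)` and `ℚˣ/Nm(K_dˣ)` in which `det H` lives are the same
quotient of `ℚˣ`**: the canonical isomorphism, the identity on representatives. [cite: vanGeemen1994HodgeAV, 4.14 and Lemma 5.2 (3)] -/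
def weilNormResidueGroupCongr {m : ℕ} (hm : m ≠ 0) (d : ℕ) :
    weilNormResidueGroup (m ^ 2 * d) ≃* weilNormResidueGroup d :=
  QuotientGroup.quotientMulEquivOfEq (normUnitsSubgroup_weilField_sq_mul hm d)

/-- The identification is the identity on representatives `q ∈ ℚˣ`. [cite: vanGeemen1994HodgeAV, 4.14] -/
@[simp] theorem weilNormResidueGroupCongr_mk {m : ℕ} (hm : m ≠ 0) (d : ℕ) (q : ℚˣ) :
    weilNormResidueGroupCongr hm d (QuotientGroup.mk q) = QuotientGroup.mk q :=
  QuotientGroup.quotientMulEquivOfEq_mk _ q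

/-- The identification takes the split class `(-1)ⁿ · Nm(K_{m²d}ˣ)` to the split class `(-1)ⁿ · Nm(K_dˣ)`.
[cite: vanGeemen1994HodgeAV, (5.4.1)] -/
@[simp] theorem weilNormResidueGroupCongr_splitDiscriminantClass {m : ℕ} (hm : m ≠ 0) (n d : ℕ) :
    weilNormResidueGroupCongr hm d (splitDiscriminantClass n (m ^ 2 * d)) = splitDiscriminantClass n d :=
  weilNormResidueGroupCongr_mk hm d _

/-- `δ` is the split class iff `congr δ` is. [cite: vanGeemen1994HodgeAV, (5.4.1)] -/
theorem weilNormResidueGroupCongr_eq_split_iff {m : ℕ} (hm : m ≠ 0) {n d : ℕ}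
    {δ : weilNormResidueGroup (m ^ 2 * d)} :
    weilNormResidueGroupCongr hm d δ = splitDiscriminantClass n d ↔ δ = splitDiscriminantClass n (m ^ 2 * d) := by
  rw [← weilNormResidueGroupCongr_splitDiscriminantClass hm n d, (weilNormResidueGroupCongr hm d).injective.eq_iff]

/-- `[K_d : ℚ] = 2` for the tree's `K_d = ℚ[X]/(X² + d)` (every `d`). [folklore] -/
theorem finrank_weilField (d : ℕ) : Module.finrank ℚ (weilField d) = 2 := by
  have hf : (X ^ 2 + C (d : ℚ) : ℚ[X]) ≠ 0 := X_pow_add_C_ne_zero (by norm_num) _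
  rw [(AdjoinRoot.powerBasis hf).finrank, AdjoinRoot.powerBasis_dim, natDegree_X_pow_add_C]

/-- Squares of rationals are norms from `K_d` (`u² = Nm(u)`). [cite: vanGeemen1994HodgeAV, 4.14] -/
theorem sq_mem_normUnitsSubgroup_weilField (d : ℕ) (u : ℚˣ) :
    u ^ 2 ∈ normUnitsSubgroup ℚ (weilField d) := by
  have h := pow_finrank_mem_normUnitsSubgroup (F := ℚ) (K := weilField d) u
  rwa [finrank_weilField] at h

/-- Multiplying a representative by an EVEN power `u^{2n} = Nm(uⁿ)` does not change the class in
`ℚˣ/Nm(K_dˣ)`. [cite: vanGeemen1994HodgeAV, 4.14] -/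
theorem mk_pow_two_mul_pow_mul (d : ℕ) (u q : ℚˣ) (n : ℕ) :
    (QuotientGroup.mk (u ^ (2 * n) * q) : weilNormResidueGroup d) = QuotientGroup.mk q := by
  rw [QuotientGroup.mk_mul, pow_mul', (QuotientGroup.eq_one_iff _).mpr
    (sq_mem_normUnitsSubgroup_weilField d (u ^ n)), one_mul]

/-! ### §2 `det H` on the carriers: equivariant pull-backs, isogenies, change of generator -/

/-- Rescaling the second half of a `Sum.elim` family by a non-zero scalar preserves linear independence.
[folklore] -/
theorem linearIndependent_sum_elim_smul_iff {ι M : Type*} [AddCommGroup M] [Module ℂ M] (x y : ι → M)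
    {c : ℂ} (hc : c ≠ 0) :
    LinearIndependent ℂ (Sum.elim x (fun i => c • y i)) ↔ LinearIndependent ℂ (Sum.elim x y) := by
  have e : Sum.elim x (fun i => c • y i) =
      (Sum.elim (fun _ => (1 : ℂˣ)) (fun _ => Units.mk0 c hc) : ι ⊕ ι → ℂˣ) • Sum.elim x y := by
    funext s
    rcases s with i | i
    · simp [Pi.smul_apply']
    · simp [Pi.smul_apply', Units.smul_def]
  rw [e, LinearIndependent.units_smul_iff]

/-- **A non-degenerate discriminant witness pulls back along a `K`-equivariant homomorphism injective on
`H¹` and on `H^{2+2(2n-1)}`** (e.g. an isogeny): for `g : B → A` with `g ≫ φ = ψ ≫ g`, if `(A, φ, h)` has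
`det H = δ` (non-degenerate) then so has `(B, ψ, g^*h)` — the `K`-basis `xᵢ ↦ g^*xᵢ` stays rational and
(with its `ψ^*`-translates `ψ^*g^*xᵢ = g^*φ^*xᵢ`) independent, `ω ↦ g^*ω ≠ 0`,
`Q_{g^*h}(g^*x, g^*y) = g^*Q_h(x, y)`, so the rational matrices `a`, `b`, the Gram matrix `Ψ` and
`det Ψ = q` are UNCHANGED. Van Geemen, Lemma 5.2 (3): "`det H` … is an isogeny invariant", on the carriers.
[cite: vanGeemen1994HodgeAV, Lemma 5.2 (3)] -/
theorem hasWeilDiscriminantNondeg_comap_of_comm {A B : AbelianVariety ℂ} {φ : A ⟶ A} {ψ : B ⟶ B} (g : B ⟶ A) (hg : g ≫ φ = ψ ≫ g)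
    (hinj₁ : Function.Injective (complexBetti.map g.hom.hom.hom 1)) {n : ℕ}
    (hinj₂ : Function.Injective (complexBetti.map g.hom.hom.hom (2 + 2 * (2 * n - 1))))
    {d : ℕ} {h : complexBetti A.X 2} {δ : weilNormResidueGroup d}
    (hA : HasWeilDiscriminantNondeg A φ n d h δ) :
    HasWeilDiscriminantNondeg B ψ n d (complexBetti.map g.hom.hom.hom 2 h) δ := by
  obtain ⟨x, ω, a, b, q, hx, hind, hω, hω0, hQ, hdet, hq⟩ := hA
  have key : ∀ i, complexBetti.map ψ.hom.hom.hom 1 (complexBetti.map g.hom.hom.hom 1 (x i)) =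
      complexBetti.map g.hom.hom.hom 1 (complexBetti.map φ.hom.hom.hom 1 (x i)) := fun i => by
    rw [map_map_hom_apply, map_map_hom_apply, hg]
  refine ⟨fun i => complexBetti.map g.hom.hom.hom 1 (x i), complexBetti.map g.hom.hom.hom _ ω, a, b, q,
    fun i => isRationalClass_complexBetti_map g.hom.hom.hom (hx i), ?_,
    isRationalClass_complexBetti_map g.hom.hom.hom hω, ?_, fun i j => ⟨?_, ?_⟩, hdet, hq⟩
  · have e1 : Sum.elim (fun i => complexBetti.map g.hom.hom.hom 1 (x i))
        (fun i => complexBetti.map ψ.hom.hom.hom 1 (complexBetti.map g.hom.hom.hom 1 (x i))) =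
        (complexBetti.map g.hom.hom.hom 1).hom ∘
          Sum.elim x (fun i => complexBetti.map φ.hom.hom.hom 1 (x i)) := by
      funext s
      rcases s with i | i
      · rfl
      · exact key i
    rw [e1]
    exact hind.map_injOn _ hinj₁.injOn
  · intro h0
    exact hω0 (hinj₂ (by rw [h0, map_zero]))
  · rw [key j, ← map_polarizationPairingOne, (hQ i j).1, map_smul]
  · rw [← map_polarizationPairingOne, (hQ i j).2, map_smul]

/-- **`det H` is an invariant of `K`-equivariant isogenies** (van Geemen, Lemma 5.2 (3), every class, on
the carriers): for an isogeny `g : B → A` with `g ≫ φ = ψ ≫ g`, `(A, φ, h)` has non-degenerate discriminant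
class `δ` iff `(B, ψ, g^*h)` has (`←`: pull back along the equivariant quasi-inverse `g'`,
`g'^*g^*h = N²·h`, and rescale by `N² ∈ ℚˣ`). [cite: vanGeemen1994HodgeAV, Lemma 5.2 (3)]
[cite: MumfordAV1970, §19 Thm. 3 and Remark p. 169] -/
theorem hasWeilDiscriminantNondeg_iff_of_isIsogeny {A B : AbelianVariety ℂ} {φ : A ⟶ A} {ψ : B ⟶ B}
    {g : B ⟶ A} (hgi : AbelianVariety.IsIsogeny g) (hg : g ≫ φ = ψ ≫ g) {n d : ℕ}
    {h : complexBetti A.X 2} {δ : weilNormResidueGroup d} :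
    HasWeilDiscriminantNondeg A φ n d h δ ↔
      HasWeilDiscriminantNondeg B ψ n d (complexBetti.map g.hom.hom.hom 2 h) δ := by
  refine ⟨fun hA => hasWeilDiscriminantNondeg_comap_of_comm g hg
      (complexBetti_map_bijective_of_isIsogeny hgi 1).1 (complexBetti_map_bijective_of_isIsogeny hgi _).1 hA,
    fun hB => ?_⟩
  obtain ⟨g', N, hN, hgg', hg'g⟩ := AbelianVariety.IsIsogeny.exists_nsmul_inverse_holds hgi
  have hcomm : g' ≫ ψ = φ ≫ g' := comm_of_nsmul_inverse hg hN.ne' hgg' hg'g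
  have h' := hasWeilDiscriminantNondeg_comap_of_comm g' hcomm
    (complexBetti_map_injective_of_comp_eq_nsmul_id hN.ne' hgg' 1)
    (complexBetti_map_injective_of_comp_eq_nsmul_id hN.ne' hgg' _) hB
  rw [complexBetti_map_map_of_comp_eq_nsmul_id hg'g,
    show ((N : ℂ) ^ 2) = (((N : ℚ) ^ 2 : ℚ) : ℂ) by norm_cast] at h'
  exact (hasWeilDiscriminantNondeg_ratCast_smul_iff (pow_ne_zero 2 (Nat.cast_ne_zero.mpr hN.ne'))).1 h'

/-- **Change of generator on one variety: `(B, mψ, m²d, h)` has discriminant class `δ` iff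
`(B, ψ, d, h)` has class `congr δ`** (`m ≥ 1`). In a `K`-basis `{xᵢ}` (the same for both: `(mψ)^* =
m·ψ^*` on `H¹`), with `Q_h(xᵢ, (mψ)^*xⱼ) = aᵢⱼ ω`, `Q_h(xᵢ, xⱼ) = bᵢⱼ ω`, the Gram matrix of
`(ψ, √-d)` is `m⁻¹a + b√-d` and `a + b√-(m²d) ↦ a + mb√-d = m·(m⁻¹a + b√-d)` under `K_{m²d} ≃ K_d`:
`det` changes by `m^{2n} = Nm(mⁿ)`, the class in `ℚˣ/Nm(Kˣ)` not at all. [cite: vanGeemen1994HodgeAV, Lemma 5.2 (2)–(3)]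
[cite: MumfordAV1970, §19] -/
theorem hasWeilDiscriminantNondeg_natCast_zsmul_iff {B : AbelianVariety ℂ} {ψ : B ⟶ B} {m : ℕ}
    (hm : m ≠ 0) {n d : ℕ} {h : complexBetti B.X 2} {δ : weilNormResidueGroup (m ^ 2 * d)} :
    HasWeilDiscriminantNondeg B ((m : ℤ) • ψ) n (m ^ 2 * d) h δ ↔
      HasWeilDiscriminantNondeg B ψ n d h (weilNormResidueGroupCongr hm d δ) := by
  have hmQ : (m : ℚ) ≠ 0 := Nat.cast_ne_zero.mpr hm
  have hmC : (m : ℂ) ≠ 0 := Nat.cast_ne_zero.mpr hm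
  have hψm : ∀ y : complexBetti B.X 1, complexBetti.map ((m : ℤ) • ψ).hom.hom.hom 1 y =
      (m : ℂ) • complexBetti.map ψ.hom.hom.hom 1 y := fun y => by
    rw [complexBetti_map_natCast_zsmul_apply, pow_one]
  have e1 : ∀ x : Fin (2 * n) → complexBetti B.X 1,
      Sum.elim x (fun i => complexBetti.map ((m : ℤ) • ψ).hom.hom.hom 1 (x i)) =
        Sum.elim x (fun i => (m : ℂ) • complexBetti.map ψ.hom.hom.hom 1 (x i)) := fun x => by
    funext s
    rcases s with i | i
    · rfl
    · exact hψm (x i)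
  constructor
  · rintro ⟨x, ω, a, b, q, hx, hind, hω, hω0, hQ, hdet, hq⟩
    refine ⟨x, ω, (m : ℚ)⁻¹ • a, b, (Units.mk0 (m : ℚ) hmQ ^ (2 * n))⁻¹ * q, hx, ?_, hω, hω0,
      fun i j => ⟨?_, (hQ i j).2⟩, ?_, ?_⟩
    · rw [e1, linearIndependent_sum_elim_smul_iff _ _ hmC] at hind
      exact hind
    · have h1 := (hQ i j).1
      rw [hψm, map_smul] at h1
      rw [Matrix.smul_apply, smul_eq_mul, Rat.cast_mul, Rat.cast_inv, Rat.cast_natCast, mul_smul, ← h1,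
        smul_smul, inv_mul_cancel₀ hmC, one_smul]
    · rw [det_weilGramMatrix_inv_smul hmQ (weilField_rescale_eq m d), hdet, weilFieldHom_algebraMap,
        ← map_mul, Units.val_mul, Units.val_inv_eq_inv_val, Units.val_pow_eq_pow_val, Units.val_mk0]
    · rw [← hq, weilNormResidueGroupCongr_mk, ← inv_pow]
      exact mk_pow_two_mul_pow_mul d _ q n
  · rintro ⟨x, ω, a, b, q, hx, hind, hω, hω0, hQ, hdet, hq⟩
    refine ⟨x, ω, (m : ℚ) • a, b, Units.mk0 (m : ℚ) hmQ ^ (2 * n) * q, hx, ?_, hω, hω0,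
      fun i j => ⟨?_, (hQ i j).2⟩, ?_, ?_⟩
    · rw [e1, linearIndependent_sum_elim_smul_iff _ _ hmC]
      exact hind
    · rw [hψm, map_smul, (hQ i j).1, smul_smul, Matrix.smul_apply, smul_eq_mul, Rat.cast_mul,
        Rat.cast_natCast]
    · rw [show ((m : ℚ) • a) = ((m : ℚ)⁻¹)⁻¹ • a by rw [inv_inv],
        det_weilGramMatrix_inv_smul (inv_ne_zero hmQ) (weilField_rescale_inv_eq hm d), hdet,
        weilFieldHom_algebraMap, ← map_mul, inv_pow, inv_inv, Units.val_mul, Units.val_pow_eq_pow_val,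
        Units.val_mk0]
    · apply (weilNormResidueGroupCongr hm d).injective
      rw [weilNormResidueGroupCongr_mk, ← hq]
      exact mk_pow_two_mul_pow_mul d _ q n

/-- The `K`-symmetrised hyperplane class of `(mφ, m²d)` has class `δ` iff that of `(φ, d)` has class
`congr δ` (same variety; `m²d·y + (mφ)^*y = m²·(d·y + φ^*y)` and `m² ∈ ℚˣ` rescales away).
[cite: vanGeemen1994HodgeAV, Lemma 5.2 (3)] [cite: MumfordAV1970, §19] -/
theorem hasWeilDiscriminantNondeg_symmetrised_natCast_zsmul_iff {B : AbelianVariety ℂ} {ψ : B ⟶ B}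
    {m : ℕ} (hm : m ≠ 0) {n d : ℕ} (y : complexBetti B.X 2) {δ : weilNormResidueGroup (m ^ 2 * d)} :
    HasWeilDiscriminantNondeg B ((m : ℤ) • ψ) n (m ^ 2 * d)
        (((m ^ 2 * d : ℕ) : ℂ) • y + complexBetti.map ((m : ℤ) • ψ).hom.hom.hom 2 y) δ ↔
      HasWeilDiscriminantNondeg B ψ n d ((d : ℂ) • y + complexBetti.map ψ.hom.hom.hom 2 y)
        (weilNormResidueGroupCongr hm d δ) := by
  rw [symmetrised_natCast_zsmul, show ((m : ℂ) ^ 2) = (((m : ℚ) ^ 2 : ℚ) : ℂ) by norm_cast,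
    hasWeilDiscriminantNondeg_ratCast_smul_iff (pow_ne_zero 2 (Nat.cast_ne_zero.mpr hm)),
    hasWeilDiscriminantNondeg_natCast_zsmul_iff hm]

end Summit.HodgeConjecture.HodgeConjecture.Ring2.AbelianAll

end
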